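import Mathlib.Algebra.Polynomial.Bivariate
import Mathlib.Topology.Algebra.Polynomial
import Summits.HubbardSuperconductivity.HubbardSuperconductivity.Theorems.BalabanIRBirEveryGroundStateAffine
import Summits.HubbardSuperconductivity.HubbardSuperconductivity.Theorems.BalabanIRBirEveryGroundStatePencil
import Summits.HubbardSuperconductivity.HubbardSuperconductivity.Theorems.BalabanIRBirEveryGroundStateSpectralCurve

/-!
# Route `BalabanIR`, crux 5 `BirEveryGroundState` (`stmt-HubbardSuperconductivity-2083`),
# line `spectral-curve-anchor`: a linear sheet through the ground point is the ground energy

Stub `stub_linearSheetForcesAffineGround` of the line skeleton. Setting: the affine Hermitian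
pencil `u ↦ T + u D` (hopping + `u` · doublon number), an invariant sector `K`, the sector
ground energy `e(u) = minEnergyOn (T + u D) K`, and a "T/U sheet" `ℓ(u) = ε + γ u` that is an
eigenvalue of `T + u D` with an eigenvector IN `K` for every complex `u`. If `e(U) = ℓ(U)` at a
coupling `U` where the number of DISTINCT eigenvalues of `T + u D` is maximal over real `u`, then
`e ≡ ℓ` on a real neighbourhood of `U`.

Proof (algebraic, no Kato theory). In `ℂ[u][λ]` the pencil's characteristic polynomial factors as
`Φ = (λ - ℓ)^m · s` with `m ≥ 1` and `g(u) := s(u, ℓ(u))` a NONZERO polynomial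
(`exists_sheet_factorisation`). KEY (`cofactor_sheet_eval_ne_zero`): `g(U) ≠ 0`. Indeed the roots
of `s(u, ·)` are real at real `u` (eigenvalues), their power sums `tr (T + u D)^j - m ℓ(u)^j`
are polynomials in `u`, so by the Hermite–Sylvester Hankel criterion
(`det_powerSumHankel_ne_zero_iff` of `…Pencil`) the number of distinct roots of `s(u, ·)` is at
least its value `k` at `U` for all but finitely many real `u`; if `g(U) = 0` the count of distinct
eigenvalues is `k` at `U` but `1 + k` at such a generic `u` with `g(u) ≠ 0`, contradicting
maximality. Granting the key: `s(u, z) ≠ 0` on a box around `(U, ℓ(U))` (continuity), `e` is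
Lipschitz in `u` and `e(u)` is a root of `Φ(u, ·)` (the minimiser is an eigenvector in `K`), so
near `U` the root `e(u)` of `(λ - ℓ(u))^m s(u, λ)` lies in the box, is no root of `s(u, ·)`, hence
equals `ℓ(u)`. Kato, *Perturbation Theory for Linear Operators* (1966) II §1.1; Gantmacher,
*Theory of Matrices* II, XV §9. Folklore; no definition introduced; no route file imported.
-/

noncomputable section

namespace Summit.HubbardSuperconductivity.HubbardSuperconductivity.Theorems

open Polynomial Matrix Finset
open Literature.MathematicalPhysics.QuantumLattice
open Literature.MathematicalPhysics.QuantumLattice.EigenvalueContinuation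
open Literature.Computability.AlgebraicComplexity
open scoped ComplexOrder

section Helpers

variable {n : Type*} [Fintype n] [DecidableEq n]

/-! ### Variational helpers: the sector energy is attained, by an eigenvector, Lipschitz in `u` -/

omit [DecidableEq n] in
/-- The sector energy `minEnergyOn A K` is attained on the (compact, non-empty) unit sphere of a
sector `K ≠ ⊥`. Tasaki (2020) §2.1. [folklore] -/
private theorem exists_unit_rayleigh_eq_minEnergyOn (A : Matrix n n ℂ) (K : Submodule ℂ (n → ℂ))
    {v : n → ℂ} (hvK : v ∈ K) (hv : v ≠ 0) :
    ∃ ψ ∈ K, star ψ ⬝ᵥ ψ = 1 ∧ (star ψ ⬝ᵥ A *ᵥ ψ).re = A.minEnergyOn K := by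
  obtain ⟨c, -, -, h1⟩ := exists_normalize hv
  have hne : {w : n → ℂ | w ∈ K ∧ star w ⬝ᵥ w = 1}.Nonempty :=
    ⟨(c : ℂ) • v, K.smul_mem _ hvK, h1⟩
  obtain ⟨w, hw, hmin⟩ :=
    (isCompact_unitSphere_inter K).exists_isMinOn hne (continuous_energy A).continuousOn
  refine ⟨w, hw.1, hw.2, ?_⟩
  symm
  refine IsLeast.csInf_eq ⟨⟨w, hw.1, hw.2, rfl⟩, ?_⟩
  rintro E ⟨ψ, hψK, hψ1, rfl⟩
  exact (isMinOn_iff.mp hmin) ψ ⟨hψK, hψ1⟩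

omit [DecidableEq n] in
/-- A sector ground vector exists: a minimiser of the Rayleigh quotient on an invariant sector
`K ≠ ⊥` of a Hermitian matrix is an eigenvector with eigenvalue `minEnergyOn A K`
(`mulVec_eq_smul_of_forall_le_on`). Tasaki (2020) §2.1. [folklore] -/
private theorem exists_sector_groundVector {A : Matrix n n ℂ} (hA : A.IsHermitian)
    (K : Submodule ℂ (n → ℂ)) (hK : ∀ v ∈ K, A *ᵥ v ∈ K) {v : n → ℂ} (hvK : v ∈ K) (hv : v ≠ 0) :
    ∃ ψ ∈ K, ψ ≠ 0 ∧ A *ᵥ ψ = ((A.minEnergyOn K : ℝ) : ℂ) • ψ := by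
  obtain ⟨ψ, hψK, hψ1, hE⟩ := exists_unit_rayleigh_eq_minEnergyOn A K hvK hv
  refine ⟨ψ, hψK, fun h => ?_, ?_⟩
  · rw [h, dotProduct_zero] at hψ1
    exact zero_ne_one hψ1
  · exact mulVec_eq_smul_of_forall_le_on hA.eq K hK (fun w hw => minEnergyOn_mul_re_le A K hw) hψK
      (by rw [hψ1, Complex.one_re, mul_one, hE])

omit [DecidableEq n] in
/-- One-sided Lipschitz bound of the sector ground energy along the pencil `u ↦ T + u D`:
`e(u) ≤ e(u') + (Σ |D i j|) |u - u'|` (variational principle with the minimiser at `u'`).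
Tasaki (2020) §2.1. [folklore] -/
private theorem minEnergyOn_pencil_le (T D : Matrix n n ℂ) (K : Submodule ℂ (n → ℂ)) {v : n → ℂ}
    (hvK : v ∈ K) (hv : v ≠ 0) (u u' : ℝ) :
    (T + (u : ℂ) • D).minEnergyOn K ≤
      (T + (u' : ℂ) • D).minEnergyOn K + (∑ i, ∑ j, ‖D i j‖) * |u - u'| := by
  obtain ⟨ψ, hψK, hψ1, hE⟩ := exists_unit_rayleigh_eq_minEnergyOn (T + (u' : ℂ) • D) K hvK hv
  have h1 := minEnergyOn_le_re_rayleigh (T + (u : ℂ) • D) K hψK hψ1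
  have hexp : ∀ w : ℝ, (star ψ ⬝ᵥ (T + (w : ℂ) • D) *ᵥ ψ).re =
      (star ψ ⬝ᵥ T *ᵥ ψ).re + w * (star ψ ⬝ᵥ D *ᵥ ψ).re := fun w => by
    rw [add_mulVec, smul_mulVec, dotProduct_add, dotProduct_smul, smul_eq_mul, Complex.add_re,
      Complex.re_ofReal_mul]
  rw [hexp] at h1 hE
  have hlo := neg_sum_norm_le_re_rayleigh D hψ1
  have hhi := neg_sum_norm_le_re_rayleigh (-D) hψ1
  rw [neg_mulVec, dotProduct_neg, Complex.neg_re] at hhi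
  simp only [Matrix.neg_apply, norm_neg] at hhi
  have habs : |(star ψ ⬝ᵥ D *ᵥ ψ).re| ≤ ∑ i, ∑ j, ‖D i j‖ := abs_le.mpr ⟨hlo, by linarith⟩
  have hprod : (u - u') * (star ψ ⬝ᵥ D *ᵥ ψ).re ≤ (∑ i, ∑ j, ‖D i j‖) * |u - u'| :=
    calc (u - u') * (star ψ ⬝ᵥ D *ᵥ ψ).re ≤ |(u - u') * (star ψ ⬝ᵥ D *ᵥ ψ).re| := le_abs_self _
      _ = |u - u'| * |(star ψ ⬝ᵥ D *ᵥ ψ).re| := abs_mul _ _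
      _ ≤ |u - u'| * ∑ i, ∑ j, ‖D i j‖ := mul_le_mul_of_nonneg_left habs (abs_nonneg _)
      _ = (∑ i, ∑ j, ‖D i j‖) * |u - u'| := mul_comm _ _
  nlinarith [h1, hE, hprod]

omit [DecidableEq n] in
/-- The sector ground energy is Lipschitz along the pencil:
`|e(u) - e(u')| ≤ (Σ |D i j|) |u - u'|`. Tasaki (2020) §2.1. [folklore] -/
private theorem abs_minEnergyOn_pencil_sub_le (T D : Matrix n n ℂ) (K : Submodule ℂ (n → ℂ))
    {v : n → ℂ} (hvK : v ∈ K) (hv : v ≠ 0) (u u' : ℝ) :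
    |(T + (u : ℂ) • D).minEnergyOn K - (T + (u' : ℂ) • D).minEnergyOn K| ≤
      (∑ i, ∑ j, ‖D i j‖) * |u - u'| := by
  have h1 := minEnergyOn_pencil_le T D K hvK hv u u'
  have h2 := minEnergyOn_pencil_le T D K hvK hv u' u
  rw [abs_sub_comm] at h2
  rw [abs_le]
  constructor <;> linarith

/-! ### Algebraic helpers -/

/-- An eigenvector makes its eigenvalue a root of the characteristic polynomial. [folklore] -/
private theorem isRoot_charpoly_of_mulVec_eq {A : Matrix n n ℂ} {v : n → ℂ} (hv : v ≠ 0) {μ : ℂ}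
    (h : A *ᵥ v = μ • v) : A.charpoly.IsRoot μ := by
  rw [IsRoot.def, eval_charpoly, ← Matrix.exists_mulVec_eq_zero_iff]
  refine ⟨v, hv, ?_⟩
  rw [sub_mulVec, h]
  ext i
  simp [Matrix.scalar_apply]

/-- Joint continuity of the evaluation `(u, z) ↦ p(u, z)` of a bivariate complex polynomial.
[folklore] -/
private theorem continuous_evalEval (p : ℂ[X][X]) :
    Continuous fun v : ℂ × ℂ => p.evalEval v.1 v.2 := by
  induction p using Polynomial.induction_on' with
  | add p q hp hq =>
    simp only [evalEval_add]
    exact hp.add hq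
  | monomial k c =>
    simp only [evalEval, eval_monomial, eval_mul, eval_pow, eval_C]
    exact (c.continuous.comp continuous_fst).mul (continuous_snd.pow k)

/-- **Hankel criterion for a real multiset** (from `det_powerSumHankel_ne_zero_iff`): the `k × k`
Hankel matrix of power sums of a finite real multiset is non-singular iff the multiset has at
least `k` distinct elements. Gantmacher, *Theory of Matrices* II, Ch. XV §9. [folklore] -/
private theorem det_hankel_multiset_ne_zero_iff (R : Multiset ℝ) (k : ℕ) :
    (Matrix.of fun a b : Fin k => (R.map (· ^ (a.val + b.val))).sum).det ≠ 0 ↔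
      k ≤ R.toFinset.card := by
  induction R using Quotient.inductionOn with
  | h L =>
    have hsum : ∀ j : ℕ, ∑ i : Fin L.length, L[(i : ℕ)] ^ j =
        (Multiset.map (· ^ j) (L : Multiset ℝ)).sum := fun j => by
      rw [← Fin.sum_ofFn, List.ofFn_getElem_eq_map (f := (· ^ j)), Multiset.map_coe,
        Multiset.sum_coe]
    have himg : Finset.univ.image (fun i : Fin L.length => L[(i : ℕ)]) =
        (L : Multiset ℝ).toFinset := by
      ext x
      simp [List.mem_iff_getElem, Fin.exists_iff]
    have h := det_powerSumHankel_ne_zero_iff (fun i : Fin L.length => L[(i : ℕ)]) k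
    rw [himg] at h
    simp only [hsum] at h
    exact h

/-- Along the pencil, the REDUCED Hankel determinant
`det (tr (T + u D)^{a+b} - m ℓ(u)^{a+b})_{a,b<k}` (`ℓ(u) = ε + γ u`) is a polynomial in `u`.
[folklore] -/
private theorem exists_polynomial_eval_eq_det_reducedHankel (T D : Matrix n n ℂ) (ε γ : ℂ)
    (m k : ℕ) :
    ∃ p : ℂ[X], ∀ u : ℂ, p.eval u = (Matrix.of fun a b : Fin k =>
      ((T + u • D) ^ (a.val + b.val)).trace - (m : ℂ) * (ε + γ * u) ^ (a.val + b.val)).det := by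
  -- adapted from `exists_polynomial_eval_eq_det_powerSumHankel` (…Pencil)
  let M : Matrix n n ℂ[X] := T.map C + (X : ℂ[X]) • D.map C
  refine ⟨(Matrix.of fun a b : Fin k => (M ^ (a.val + b.val)).trace -
    C (m : ℂ) * (C ε + C γ * X) ^ (a.val + b.val)).det, fun u => ?_⟩
  have hM : (evalRingHom u).mapMatrix M = T + u • D := by
    ext i j
    simp only [M, RingHom.mapMatrix_apply, Matrix.map_apply, Matrix.add_apply, Matrix.smul_apply,
      smul_eq_mul, coe_evalRingHom, eval_add, eval_mul, eval_C, eval_X]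
  rw [← coe_evalRingHom, RingHom.map_det]
  congr 1
  ext a b
  simp only [RingHom.mapMatrix_apply, Matrix.map_apply, of_apply, map_sub, map_mul, map_pow,
    map_add]
  rw [AddMonoidHom.map_trace (evalRingHom u) (M ^ (a.val + b.val)), ← RingHom.mapMatrix_apply,
    map_pow, hM]
  simp

/-- **The linear sheet splits off** (cf. `X_sub_C_dvd_charpoly_pencil_of_jointEigenvector`): if
`ℓ(u) = ε + γ u` is an eigenvalue of `T + u D` for every complex `u`, then in `ℂ[u][λ]` the
pencil's characteristic polynomial is `(λ - ℓ)^m · s` with `m ≥ 1` and `g(u) = s(u, ℓ(u))` a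
nonzero polynomial; all three facts specialise under `u ↦ u₁`. [folklore] -/
private theorem exists_sheet_factorisation (T D : Matrix n n ℂ) {ε γ : ℂ}
    (hline : ∀ u : ℂ, ∃ v : n → ℂ, v ≠ 0 ∧ (T + u • D) *ᵥ v = (ε + γ * u) • v) :
    ∃ (m : ℕ) (s : ℂ[X][X]), m ≠ 0 ∧ s.eval (C ε + C γ * X) ≠ 0 ∧
      (∀ u : ℂ, (T + u • D).charpoly = (X - C (ε + γ * u)) ^ m * s.map (evalRingHom u)) ∧
      (∀ u : ℂ, (s.eval (C ε + C γ * X)).eval u = (s.map (evalRingHom u)).eval (ε + γ * u)) := by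
  set Φ : ℂ[X][X] := (T.map C + (X : ℂ[X]) • D.map C).charpoly with hΦ
  set a : ℂ[X] := C ε + C γ * X with ha
  have hau : ∀ u : ℂ, evalRingHom u a = ε + γ * u := fun u => by simp [ha]
  have hΦ0 : Φ ≠ 0 := (charpoly_monic _).ne_zero
  -- evaluation on the sheet
  have hev : ∀ (p : ℂ[X][X]) (u : ℂ),
      (p.eval a).eval u = (p.map (evalRingHom u)).eval (ε + γ * u) := fun p u => by
    rw [← hau u, eval_map, eval₂_at_apply, coe_evalRingHom]
  have hdvd : (X - C a) ∣ Φ := by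
    rw [dvd_iff_isRoot, IsRoot.def]
    apply Polynomial.funext
    intro u
    obtain ⟨v, hv, hTv⟩ := hline u
    rw [hev, hΦ, charpoly_pencil_map_evalRingHom, eval_zero]
    exact (isRoot_charpoly_of_mulVec_eq hv hTv).eq_zero
  obtain ⟨s, hfac, hns⟩ := exists_eq_pow_rootMultiplicity_mul_and_not_dvd Φ hΦ0 a
  refine ⟨Φ.rootMultiplicity a, s, ?_, fun h => hns (dvd_iff_isRoot.mpr h), fun u => ?_,
    fun u => hev s u⟩
  · exact ((rootMultiplicity_pos hΦ0).mpr (dvd_iff_isRoot.mp hdvd)).ne'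
  · have h := congrArg (Polynomial.map (evalRingHom u)) hfac
    rw [hΦ, charpoly_pencil_map_evalRingHom] at h
    rw [h, Polynomial.map_mul, Polynomial.map_pow, Polynomial.map_sub, map_X, map_C, hau]

/-- **KEY: at a maximiser of the distinct-eigenvalue count the cofactor does not vanish on the
sheet.** With `charpoly (T + u D) = (X - ℓ(u))^m s_u` (`m ≥ 1`) and `g(u) = s_u(ℓ(u))` a nonzero
polynomial: if the number of distinct eigenvalues of `T + u D` is maximal at the real coupling
`U`, then `g(U) ≠ 0`. Hermite–Sylvester: the roots of `s_u` are real for real `u`, their power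
sums `tr (T + u D)^j - m ℓ(u)^j` are polynomial in `u`, so the `k × k` Hankel determinant
(`k` = number of distinct roots of `s_U`) is a polynomial non-zero at `U`, hence `s_u` has `≥ k`
distinct roots off a finite set; at such a `u` with `g(u) ≠ 0` the matrix has `1 + k` distinct
eigenvalues, at `U` only `k` if `g(U) = 0`. Kato (1966) II §1.1; Gantmacher II, XV §9.
[folklore] -/
private theorem cofactor_sheet_eval_ne_zero {T D : Matrix n n ℂ} (hT : T.IsHermitian)
    (hD : D.IsHermitian) {ε γ : ℂ} {m : ℕ} (hm : m ≠ 0) {s : ℂ[X][X]}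
    (hfac : ∀ u : ℂ, (T + u • D).charpoly = (X - C (ε + γ * u)) ^ m * s.map (evalRingHom u))
    {g : ℂ[X]} (hg0 : g ≠ 0) (hg : ∀ u : ℂ, g.eval u = (s.map (evalRingHom u)).eval (ε + γ * u))
    {U : ℝ} (hmax : ∀ u' : ℝ, (T + ((u' : ℝ) : ℂ) • D).charpoly.roots.toFinset.card ≤
      (T + (U : ℂ) • D).charpoly.roots.toFinset.card) :
    g.eval (U : ℂ) ≠ 0 := by
  classical
  -- the specialised cofactors are non-zero
  have hs0 : ∀ u : ℂ, s.map (evalRingHom u) ≠ 0 := fun u h => by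
    have := (charpoly_monic (T + u • D)).ne_zero
    rw [hfac u, h, mul_zero] at this
    exact this rfl
  -- roots and distinct roots of the specialised pencil
  have hroots : ∀ u : ℂ, (T + u • D).charpoly.roots =
      m • {ε + γ * u} + (s.map (evalRingHom u)).roots := fun u => by
    have hne : (X - C (ε + γ * u)) ^ m * s.map (evalRingHom u) ≠ 0 := by
      rw [← hfac u]; exact (charpoly_monic _).ne_zero
    rw [hfac u, roots_mul hne, roots_pow, roots_X_sub_C]
  have hfin : ∀ u : ℂ, (T + u • D).charpoly.roots.toFinset =
      insert (ε + γ * u) (s.map (evalRingHom u)).roots.toFinset := fun u => by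
    rw [hroots u, Multiset.toFinset_add, Multiset.toFinset_nsmul _ _ hm,
      Multiset.toFinset_singleton, Finset.insert_eq]
  have hmem : ∀ u : ℂ, ε + γ * u ∈ (s.map (evalRingHom u)).roots.toFinset ↔ g.eval u = 0 :=
    fun u => by rw [Multiset.mem_toFinset, mem_roots (hs0 u), IsRoot.def, hg u]
  -- at a real coupling all roots are real
  have hreal : ∀ (u : ℝ), ∀ r ∈ (s.map (evalRingHom (u : ℂ))).roots, ((r.re : ℝ) : ℂ) = r := by
    intro u r hr
    have hle : (s.map (evalRingHom (u : ℂ))).roots ≤ (T + (u : ℂ) • D).charpoly.roots := by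
      rw [hroots]; exact Multiset.le_add_left _ _
    have hr' := Multiset.mem_of_le hle hr
    rw [(isHermitian_add_real_smul hT hD u).roots_charpoly_eq_eigenvalues, Multiset.mem_map] at hr'
    obtain ⟨i, -, rfl⟩ := hr'
    change (((((isHermitian_add_real_smul hT hD u).eigenvalues i : ℝ) : ℂ)).re : ℂ) = _
    rw [Complex.ofReal_re]
    rfl
  -- the real root multiset of the cofactor and its power sums
  obtain ⟨R, hR⟩ : ∃ R : ℝ → Multiset ℝ,
      ∀ u, R u = ((s.map (evalRingHom (u : ℂ))).roots).map Complex.re := ⟨_, fun u => rfl⟩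
  have hRmap : ∀ u : ℝ, (R u).map ((↑) : ℝ → ℂ) = (s.map (evalRingHom (u : ℂ))).roots := fun u => by
    rw [hR, Multiset.map_map]
    conv_rhs => rw [← Multiset.map_id (s.map (evalRingHom (u : ℂ))).roots]
    exact Multiset.map_congr rfl fun r hr => hreal u r hr
  have hsumC : ∀ (M : Multiset ℝ) (j : ℕ), (((M.map (· ^ j)).sum : ℝ) : ℂ) =
      ((M.map ((↑) : ℝ → ℂ)).map (· ^ j)).sum := fun M j => by
    rw [← Complex.ofRealHom_eq_coe, map_multiset_sum, Multiset.map_map, Multiset.map_map]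
    refine congrArg _ (Multiset.map_congr rfl fun x _ => ?_)
    simp
  have hRcard : ∀ u : ℝ, (R u).toFinset.card =
      (s.map (evalRingHom (u : ℂ))).roots.toFinset.card := fun u => by
    rw [← hRmap u, Multiset.toFinset_map, Finset.card_image_of_injective _ Complex.ofReal_injective]
  have hpow : ∀ (u : ℝ) (j : ℕ), ((T + (u : ℂ) • D) ^ j).trace - (m : ℂ) * (ε + γ * u) ^ j =
      ((((R u).map (· ^ j)).sum : ℝ) : ℂ) := by
    intro u j
    have hA := isHermitian_add_real_smul hT hD u
    have h1 : ((T + (u : ℂ) • D) ^ j).trace =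
        (((T + (u : ℂ) • D).charpoly.roots).map (· ^ j)).sum := by
      rw [trace_pow_eq_sum_eigenvalues_pow hA j, hA.roots_charpoly_eq_eigenvalues, Multiset.map_map,
        Finset.sum_eq_multiset_sum]
      rfl
    rw [h1, hroots, Multiset.map_add, Multiset.sum_add, Multiset.map_nsmul, Multiset.sum_nsmul,
      Multiset.map_singleton, Multiset.sum_singleton, nsmul_eq_mul, add_sub_cancel_left, ← hRmap u,
      hsumC]
  -- the reduced Hankel polynomial detects `k ≤ #` distinct roots of the cofactor
  set k := (s.map (evalRingHom (U : ℂ))).roots.toFinset.card with hk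
  obtain ⟨H, hH⟩ := exists_polynomial_eval_eq_det_reducedHankel T D ε γ m k
  have hHiff : ∀ u : ℝ, H.eval (u : ℂ) ≠ 0 ↔
      k ≤ (s.map (evalRingHom (u : ℂ))).roots.toFinset.card := fun u => by
    rw [hH, ← hRcard u, ← det_hankel_multiset_ne_zero_iff (R u) k]
    have hmat : (Matrix.of fun a b : Fin k => ((T + (u : ℂ) • D) ^ (a.val + b.val)).trace -
        (m : ℂ) * (ε + γ * u) ^ (a.val + b.val)) = Complex.ofRealHom.mapMatrix
        (Matrix.of fun a b : Fin k => ((R u).map (· ^ (a.val + b.val))).sum) := by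
      ext a b
      simp only [RingHom.mapMatrix_apply, Matrix.map_apply, of_apply, Complex.ofRealHom_eq_coe]
      exact hpow u _
    rw [hmat, ← RingHom.map_det, Complex.ofRealHom_eq_coe, Complex.ofReal_ne_zero]
  -- contradiction with maximality
  intro hgU
  have hHU : H.eval (U : ℂ) ≠ 0 := (hHiff U).mpr le_rfl
  have hH0 : H ≠ 0 := fun h => hHU (by rw [h, eval_zero])
  obtain ⟨u₁, hu₁⟩ :=
    Infinite.exists_notMem_finset ((H.roots.toFinset ∪ g.roots.toFinset).image Complex.re)
  have hnot : ∀ p : ℂ[X], p ≠ 0 → p.roots.toFinset ⊆ H.roots.toFinset ∪ g.roots.toFinset →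
      p.eval (u₁ : ℂ) ≠ 0 := fun p hp hsub h0 =>
    hu₁ (Finset.mem_image.mpr
      ⟨u₁, hsub (Multiset.mem_toFinset.mpr ((mem_roots hp).mpr h0)), Complex.ofReal_re u₁⟩)
  have hHu₁ := hnot H hH0 Finset.subset_union_left
  have hgu₁ := hnot g hg0 Finset.subset_union_right
  have h1 : k ≤ (s.map (evalRingHom (u₁ : ℂ))).roots.toFinset.card := (hHiff u₁).mp hHu₁
  have h2 : (T + ((u₁ : ℝ) : ℂ) • D).charpoly.roots.toFinset.card =
      (s.map (evalRingHom (u₁ : ℂ))).roots.toFinset.card + 1 := by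
    rw [hfin, Finset.card_insert_of_notMem]
    rwa [hmem]
  have h3 : (T + (U : ℂ) • D).charpoly.roots.toFinset.card = k := by
    rw [hfin, Finset.insert_eq_of_mem ((hmem _).mpr hgU)]
  have h4 := hmax u₁
  omega

end Helpers

/-! ### The stub -/

/-- **A linear sheet through the ground point at a non-exceptional coupling IS the ground energy
nearby** (stub `stub_linearSheetForcesAffineGround` of line `spectral-curve-anchor`). Let `T, D`
be Hermitian and preserve `K`, `e(u) = minEnergyOn (T + u D) K`, and let `ℓ(u) = ε + γ u` be an
eigenvalue of `T + u D` with an eigenvector in `K` for every complex `u`. If `e(U) = ℓ(U)` at a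
coupling `U` maximising the number of distinct eigenvalues of `T + u D` over real `u`, then
`e(u) = ℓ(u)` for all real `u` near `U`. Proof: `charpoly (T + u D) = (X - ℓ(u))^m s_u` with
`s_U(ℓ(U)) ≠ 0` (`cofactor_sheet_eval_ne_zero`); `s_u(z) ≠ 0` near `(U, ℓ(U))` by continuity;
`e` is Lipschitz and `e(u)` is an eigenvalue (root of the characteristic polynomial), so near `U`
it is a root of `(X - ℓ(u))^m`. Kato (1966) II §1.1. [folklore] -/
theorem stub_linearSheetForcesAffineGround {n : Type} [Fintype n] [DecidableEq n]
    (T D : Matrix n n ℂ) (hT : T.IsHermitian) (hD : D.IsHermitian) (K : Submodule ℂ (n → ℂ))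
    (hTK : ∀ v ∈ K, T *ᵥ v ∈ K) (hDK : ∀ v ∈ K, D *ᵥ v ∈ K) (U : ℝ)
    (hmax : ∀ u' : ℝ, (T + ((u' : ℝ) : ℂ) • D).charpoly.roots.toFinset.card ≤
      (T + (U : ℂ) • D).charpoly.roots.toFinset.card)
    (ε γ : ℂ) (hε : (((T + (U : ℂ) • D).minEnergyOn K : ℝ) : ℂ) = ε + γ * (U : ℂ))
    (hline : ∀ u : ℂ, ∃ v ∈ K, v ≠ 0 ∧ (T + u • D) *ᵥ v = (ε + γ * u) • v) :
    ∃ η : ℝ, 0 < η ∧ ∀ u ∈ Set.Ioo (U - η) (U + η),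
      (((T + (u : ℂ) • D).minEnergyOn K : ℝ) : ℂ) = ε + γ * (u : ℂ) := by
  classical
  -- a nonzero vector of `K`
  obtain ⟨v₀, hv₀K, hv₀, -⟩ := hline 0
  -- the sheet splits off the pencil's characteristic polynomial; the cofactor is clean at `U`
  obtain ⟨m, s, hm, hg0, hfac, hg⟩ := exists_sheet_factorisation T D
    (ε := ε) (γ := γ) fun u => by
      obtain ⟨v, -, hv, h⟩ := hline u
      exact ⟨v, hv, h⟩
  have hkey : (s.eval (C ε + C γ * X)).eval (U : ℂ) ≠ 0 :=
    cofactor_sheet_eval_ne_zero hT hD hm hfac hg0 hg hmax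
  -- the cofactor does not vanish on a box around `(U, ℓ(U)) = (U, e(U))`
  have hF0 : s.evalEval (U : ℂ) (((T + (U : ℂ) • D).minEnergyOn K : ℝ) : ℂ) ≠ 0 := by
    rwa [hε, ← map_evalRingHom_eval, ← hg]
  obtain ⟨δ, hδ, hball⟩ := Metric.eventually_nhds_iff.1
    (((continuous_evalEval s).continuousAt
      (x := ((U : ℂ), (((T + (U : ℂ) • D).minEnergyOn K : ℝ) : ℂ)))).eventually_ne hF0)
  -- Lipschitz constant of `e` and the neighbourhood
  set Cd : ℝ := ∑ i, ∑ j, ‖D i j‖ with hCd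
  have hCd0 : 0 ≤ Cd := Finset.sum_nonneg fun i _ => Finset.sum_nonneg fun j _ => norm_nonneg _
  refine ⟨δ / (Cd + 1), by positivity, fun u hu => ?_⟩
  have huU : |u - U| < δ / (Cd + 1) := by
    rw [abs_lt]
    constructor <;> linarith [hu.1, hu.2]
  have huU' : |u - U| < δ := huU.trans_le (div_le_self hδ.le (by linarith))
  have heU : |(T + (u : ℂ) • D).minEnergyOn K - (T + (U : ℂ) • D).minEnergyOn K| < δ :=
    calc |(T + (u : ℂ) • D).minEnergyOn K - (T + (U : ℂ) • D).minEnergyOn K|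
        ≤ Cd * |u - U| := abs_minEnergyOn_pencil_sub_le T D K hv₀K hv₀ u U
      _ ≤ Cd * (δ / (Cd + 1)) := mul_le_mul_of_nonneg_left huU.le hCd0
      _ < δ := by
          rw [mul_div_assoc', div_lt_iff₀ (by positivity)]
          linarith
  -- the ground vector at `u`: `e(u)` is a root of `(X - ℓ(u))^m s_u`
  have hA : (T + (u : ℂ) • D).IsHermitian := isHermitian_add_real_smul hT hD u
  have hinv : ∀ w ∈ K, (T + (u : ℂ) • D) *ᵥ w ∈ K := fun w hw => by
    rw [add_mulVec, smul_mulVec]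
    exact K.add_mem (hTK w hw) (K.smul_mem _ (hDK w hw))
  obtain ⟨ψ, -, hψ0, heig⟩ := exists_sector_groundVector hA K hinv hv₀K hv₀
  have hroot := isRoot_charpoly_of_mulVec_eq hψ0 heig
  rw [hfac (u : ℂ), IsRoot.def, eval_mul, eval_pow, eval_sub, eval_X, eval_C, mul_eq_zero] at hroot
  rcases hroot with h | h
  · exact sub_eq_zero.mp ((pow_eq_zero_iff hm).mp h)
  · exfalso
    refine hball (y := ((u : ℂ), (((T + (u : ℂ) • D).minEnergyOn K : ℝ) : ℂ))) ?_ ?_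
    · rw [Prod.dist_eq, max_lt_iff, Complex.dist_eq, Complex.dist_eq, ← Complex.ofReal_sub,
        ← Complex.ofReal_sub, Complex.norm_real, Complex.norm_real, Real.norm_eq_abs,
        Real.norm_eq_abs]
      exact ⟨huU', heU⟩
    · rwa [map_evalRingHom_eval] at h

end Summit.HubbardSuperconductivity.HubbardSuperconductivity.Theorems
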